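import Summits.BirchSwinnertonDyer.BirchSwinnertonDyer.Theorems.MordellShaFreeCutThreeAdicHsiehDescentAt
import Summits.BirchSwinnertonDyer.BirchSwinnertonDyer.Theorems.MordellShaFreeCutThreeAdicBDPExistsValue
import Summits.BirchSwinnertonDyer.BirchSwinnertonDyer.Theorems.ClassRecordThreeUnramifiedFixedByOpen
import Summits.BirchSwinnertonDyer.Rank1Residual.X11b.Three.ValueReciprocityDictionary
import Summits.BirchSwinnertonDyer.Rank1Residual.X11b.LambdaSupplyPrime
import Summits.BirchSwinnertonDyer.Rank1Residual.X11b.EmbeddingDatumPrime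
import Literature.NumberTheory.EllipticCurves.Hsieh2014.AnticyclotomicPAdicLFunctionAnyLevel
import Literature.NumberTheory.EllipticCurves.BDPCentralValueReciprocity
import Literature.NumberTheory.EllipticCurves.HeegnerFieldDescentProofs
import Literature.FieldTheory.AlgClosed.PadicAlgClEquivComplex
import HarnessLib

set_option linter.dupNamespace false
set_option autoImplicit false

/-! # Route `MordellShaFreeCut` (rung S2b) — the EXISTENCE HALF of the BDP road FROM PRINT at the road's own Heegner fields:
(LB-exist) at every `j = 0` datum with `d_K` ODD ⟸ (T1) Hsieh 2014 Thm A + Tate–Sen + Bertolini–Darmon–Prasanna 2013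
Thm 5.5 — three NAMED PRINTED facts — and crux B ⟸ those + (LB-bdp) + (LB-wan) + six refereed facts

Cell `bsd-cn100`, prover seat `bsd-cn100-s2b-c3` (g8). Supports, does not close, stmt-BirchSwinnertonDyer-19160 (crux B
`AnalyticRankOneOfRankOneFiniteShaThree`); serves stmt-19159's `stub_threeAdicBDPElementExistsWithValue` (existence half).
THEOREMS ONLY (0 def, 0 new fact). WHY ODD `d_K` SUFFICES: the crux-B plumbing CHOOSES its Heegner field by Hoffstein–Luo with
`d_K ≡ 1 (mod 8)` (`exists_heegnerField_descent_of_mordellWeilRank_eq_one_of_finite_sha`), so every statement of the road may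
be restricted to imaginary quadratic `K` of ODD discriminant — and there the value-reciprocity clause of the descent is the
PRINTED theorem BDP13 Thm. 5.5 / (5.1.16) / Prop. 1.12 (1) / Lemma 5.3 (3), the tree's named fact
`Literature.NumberTheory.EllipticCurves.bertoliniDarmonPrasanna2013_centralValue_reciprocity` (p419864; `Aut(ℂ/F)`-reciprocity
of `L(f/K,χ,1)/(π^{2n+1}Ω^{4n})`, `F ⊇ K` unramified above odd split primes; `d_K` odd, Heegner), exactly as team x11b3 /
bsd-stepL closed their `3 ∥ N` item 19281 (`ClassRecordThreeOpenValueReciprocityOfBDP`).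

* §1 `valueReciprocityAt_of_bdp2013` — BDP13 fact ⟹ the sharp clause AT every `j = 0` datum with `d_K` odd (x11b3's
  archimedean glue verbatim: the ramification clause at `ℓ = 3`, T6-OPEN
  `UnramifiedOpen.exists_level_forall_fixing_rootsOfUnity_apply_symm_eq`, and the dictionary
  `X11b.Three.bdpInterpolationValue_exact_of_normalizedValue_exact` with `a₃ ∈ ℤ`).
* §2 **`threeAdicBDPElementExistsOddDisc_of_anyLevel_of_tateSen_of_bdp2013`** — (LB-exist) at every `j = 0` datum with `d_K`
  odd ⟸ (T1) `Hsieh2014.thmA_exists_isHsiehLFunction_unrPeriod_anyLevel` + `TateSenCharacterVanishing 3` + the BDP13 fact: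
  embedding datum (`X11b.exists_datum_forall_mem_iff`), `λ`-supply (`X11b.lambdaSupplyAt`), Hsieh witness from (T1), descent
  by the POINTWISE engine `MordellShaFreeCutThreeAdicHsiehDescentAt` (p486913's proof) fed with §1.
* §3 `heegnerNonTorsionOddDisc_of_linkA_of_existsOddDisc_of_value_of_wan` — p478070's rank-currency plumbing re-run with the
  binder `Odd d_K` and (LB-exist)-odd + the ∀-frame value formula (LB-bdp) in place of EV∃ (one `obtain` becomes two).
* §4 `analyticRankOne_of_facts_of_heegnerNonTorsionOddDisc` — the v2 composition choosing a Heegner field with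
  `d_K ≡ 1 (mod 8)` (`exists_heegnerField_descent_…`), so non-torsion is needed at ODD `d_K` only.
* §5 **`cruxB_of_anyLevel_of_tateSen_of_bdp2013_of_value_of_wan`** — KERNEL CENSUS: crux B ⟸ six refereed facts + THREE
  PRINTED NAMED FACTS {(T1), Tate–Sen, BDP13} + (LB-bdp) ∀-frame `ThreeAdicBDPValueAtOne` [WRITTEN] + (LB-wan)
  `ThreeAdicWanDivisibility` [OPEN]. The EXISTENCE HALF HAS LEFT THE RESEARCH COLUMN of the S2b BDP road.
HONEST FRAMING: CONDITIONAL theorems; the three named facts are PUBLISHED theorems carried as hypotheses (reads owed / done), not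
discharged in the tree; nothing here proves (LB-bdp), (LB-wan), crux A/B, the leaf, Sylvester's conjecture or any case of BSD;
T exactly as open as before. PARTITION: none — RANK axis.
References: [BertoliniDarmonPrasanna2013] Thm. 5.5, (5.1.16), Prop. 1.12 (1), Lemma 5.3; [Hsieh2014] Thm. A; [BrinonConrad2009]
Thm 2.2.7; [HoffsteinLuo1997] Thm.; [CastellaGrossiLeeSkinner2022] §5.2; [GrossZagier1986] I.6.3; [Kato2004Asterisque] Cor. 14.3. -/

noncomputable section

open scoped NumberField Classical
open NumberField IsDedekindDomain Field PowerSeries WeierstrassCurve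
open Literature.NumberTheory.GaloisRepresentations Literature.NumberTheory.GaloisCohomology Literature.NumberTheory.EllipticCurves
  Literature.NumberTheory.EllipticCurves.ModularForms Literature.NumberTheory.QuadraticFields
  Literature.NumberTheory.EllipticCurves.Castella2018
open Literature.NumberTheory.PAdicHodge (TateSenCharacterVanishing)
open Summit.BirchSwinnertonDyer.BirchSwinnertonDyer.Theses.MordellShaFreeCut (AnalyticRankOneOfRankOneFiniteShaThree)
open Summit.BirchSwinnertonDyer.BirchSwinnertonDyer.Theorems.MordellShaFreeCutThreeAdicLinks (ThreeAdicControlOfRankOne)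
open Summit.BirchSwinnertonDyer.BirchSwinnertonDyer.Theorems.MordellShaFreeCutThreeAdicBDPTriple
  (ThreeAdicWanDivisibility ThreeAdicBDPValueAtOne)
open Summit.BirchSwinnertonDyer.BirchSwinnertonDyer.Theorems.MordellShaFreeCutCensusPTFree (threeAdicControlOfRankOne_holds)
open Summit.BirchSwinnertonDyer.BirchSwinnertonDyer.Theorems.MordellShaFreeCutThreeAdicHsiehDescentAt
  (threeAdicHsiehDescentAt_of_tateSenCharacter_of_valueReciprocityAt)
open Summit.BirchSwinnertonDyer.BirchSwinnertonDyer.Theorems (UnramifiedOpen.exists_level_forall_fixing_rootsOfUnity_apply_symm_eq)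

namespace Summit.BirchSwinnertonDyer.BirchSwinnertonDyer.Theorems.MordellShaFreeCutThreeAdicExistenceFromPrint

/-! ## §1 The value-reciprocity clause at ODD `d_K` from BDP13 Thm 5.5 (x11b3's archimedean glue) -/

/-- **BDP13 ⟹ the sharp value-reciprocity clause AT every `j = 0` datum with `d_K` odd.** For `W/ℚ` elliptic, `f` its newform
of level `N = N_W`, `K` imaginary quadratic with ODD discriminant, the Heegner hypothesis for `N` and `3` split, `v` a prime of
`K`, `κ`, and `ι′ : ℚ̄₃ ≃ ℂ`: the named fact `bertoliniDarmonPrasanna2013_centralValue_reciprocity` yields `Ω ≠ 0`, `m ≥ 1`,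
`3 ∤ m` with `σ(bdpInterpolationValue 3 f v χ n Ω) = bdpInterpolationValue 3 f v χ^σ n Ω` for every `τ` fixing `μ_m`, `σ`
over `τ`, `χ` everywhere unramified of type `(n, −n)`. PROOF = x11b3's `openValueReciprocityAtThree_of_archimedeanReciprocity`:
`F` is unramified above `3` (odd, split), T6-OPEN gives `m`, `σ = ι′τι′⁻¹` fixes `F`, the dictionary transports exactness
(`a₃(f) ∈ ℤ`). CONDITIONAL on the fact. [cite: BertoliniDarmonPrasanna2013, Thm. 5.5 and (5.1.16) (p. 60)]
[cite: Castella2018, Thm. 3.1 (arXiv:1704.06608 p. 9)] [cite: SerreLocalFields1979, Ch. IV §4 Prop. 16 and Cor. 1] -/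
theorem valueReciprocityAt_of_bdp2013 (hBDP : bertoliniDarmonPrasanna2013_centralValue_reciprocity)
    (W : WeierstrassCurve ℚ) [W.IsElliptic] (ι' : PadicAlgCl 3 ≃+* ℂ) (K : Type) [Field K] [NumberField K]
    (v : HeightOneSpectrum (𝓞 K)) (κ : ZpExtension K 3) {N : ℕ} [NeZero N]
    (f : CuspForm (CongruenceSubgroup.Gamma0 N) 2) (hf : IsNewformOf W f) (hN : W.conductorNorm ℤ = N)
    (hK : IsImaginaryQuadratic K) (hodd : Odd (NumberField.discr K)) (hHN : SatisfiesHeegnerHypothesis N K)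
    (hsplit : ((Ideal.span {(3 : ℤ)}).primesOver (𝓞 K)).ncard = 2) :
    ∃ Ω : ℂ, Ω ≠ 0 ∧ ∃ m : ℕ, 0 < m ∧ ¬ 3 ∣ m ∧
      (∀ (τ : PadicAlgCl 3 ≃ₐ[ℚ_[3]] PadicAlgCl 3) (σ : ℂ ≃ₐ[ℚ] ℂ),
        (∀ ζ : PadicAlgCl 3, ζ ^ m = 1 → τ ζ = ζ) →
        (∀ z : PadicAlgCl 3, σ (ι' z) = ι' (τ z)) →
        ∀ (χ : HeckeCharacter K) (n : ℕ), 0 < n →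
          (∀ w : HeightOneSpectrum (𝓞 K), χ.IsUnramifiedAt w) →
          ∀ hχ : χ.HasInfinityType (fun _ ↦ (n : ℤ)) (fun _ ↦ -(n : ℤ)),
            ∀ r : FramedGaloisRep K (PadicAlgCl 3) 1, IsPAdicAvatarOf ι' χ r → FactorsThroughZp κ r →
              σ (bdpInterpolationValue 3 f v χ n Ω) = bdpInterpolationValue 3 f v (hχ.autConj σ) n Ω) := by
  haveI : Fact (Nat.Prime 3) := ⟨Nat.prime_three⟩
  obtain ⟨Ω, F, hΩ, hFd, -, hunrF, hexact⟩ := hBDP W K f hf hN hK hodd hHN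
  have hunr3 : ∀ P : Ideal (𝓞 F), P.IsPrime → ((3 : ℕ) : 𝓞 F) ∈ P → P.ramificationIdx (𝓞 ℚ) = 1 :=
    hunrF 3 Nat.prime_three (by decide) hsplit
  obtain ⟨m, hm, h3m, hfix⟩ := UnramifiedOpen.exists_level_forall_fixing_rootsOfUnity_apply_symm_eq 3 ι' F hFd hunr3
  refine ⟨Ω, hΩ, m, hm, h3m, fun τ σ hτ hστ χ n hn hunrχ hχ _ _ _ ↦ ?_⟩
  have hσF : ∀ x : ℂ, x ∈ F → σ x = x := fun x hx ↦ by
    have h := hστ (ι'.symm x)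
    rwa [ι'.apply_symm_apply, hfix τ hτ x hx, ι'.apply_symm_apply] at h
  exact Summit.BirchSwinnertonDyer.Rank1Residual.X11b.Three.bdpInterpolationValue_exact_of_normalizedValue_exact 3
    (Summit.BirchSwinnertonDyer.Rank1Residual.X11b.Three.exists_int_cuspCoeff_eq_of_isNewformOf hf 3) v hχ
    n Ω σ (hexact σ hσF χ n hn hunrχ hχ)

/-! ## §2 (LB-exist) at ODD `d_K` from the three printed named facts -/

/-- **(LB-exist) at every `j = 0` datum with `d_K` ODD ⟸ {(T1) Hsieh 2014 Thm A at any level, Tate–Sen, BDP13 Thm 5.5}.**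
For `W/ℚ` globally minimal with `j = 0`, `K` imaginary quadratic of odd discriminant with the Heegner hypothesis for
`N = N_W` and `3` split, `Dt` of level `N`, `v ∋ 3`, `κ` anticyclotomic with generator `γ`: an embedding datum `ι′` inducing
`v` and an `R₀`-frame `(Ω_K ≠ 0, Ω_p ∈ R₀ˣ, 𝓛 ∈ R₀⟦T⟧)` with `IsBDPLFunction ι′ v κ γ Dt.f Ω_K Ω_p 𝓛` EXIST. Proof: `ι′`
(`X11b.exists_datum_forall_mem_iff`), `λ` (`X11b.lambdaSupplyAt`), the Hsieh witness (`hT1`), the descent by the pointwise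
engine fed with §1. CONDITIONAL on the three named facts (NOT asserted); credits nothing beyond the reduction.
[cite: Hsieh2014, Thm. A p. 712 = Thm. 1 (arXiv:1112.1580 pp. 3–4)] [cite: BrinonConrad2009, Thm. 2.2.7]
[cite: BertoliniDarmonPrasanna2013, Thm. 5.5 and (5.1.16) (p. 60)] -/
theorem threeAdicBDPElementExistsOddDisc_of_anyLevel_of_tateSen_of_bdp2013
    (hT1 : Hsieh2014.thmA_exists_isHsiehLFunction_unrPeriod_anyLevel) (hTS : TateSenCharacterVanishing 3)
    (hBDP : bertoliniDarmonPrasanna2013_centralValue_reciprocity) :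
    ∀ (W : WeierstrassCurve ℚ) [W.IsElliptic] [W.IsGloballyMinimal], W.j = 0 →
      ∀ (K : Type) [Field K] [NumberField K] (N : ℕ) [NeZero N]
        (Dt : ModularParametrizationData W N)
        (v : HeightOneSpectrum (𝓞 K)) (κ : ZpExtension K 3) (γ : absoluteGaloisGroup K)
        [Fact (κ.IsTopGenerator γ)],
      W.conductorNorm ℤ = N → IsImaginaryQuadratic K → Odd (NumberField.discr K) →
      SatisfiesHeegnerHypothesis N K → ((Ideal.span {(3 : ℤ)}).primesOver (𝓞 K)).ncard = 2 →
      ((3 : ℕ) : 𝓞 K) ∈ v.asIdeal → κ.IsAnticyclotomic →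
      ∃ ι' : PadicAlgCl 3 ≃+* ℂ,
        (∀ (w : InfinitePlace K) (k : 𝓞 K), k ∈ v.asIdeal ↔ ‖ι'.symm (w.embedding (k : K))‖ < 1) ∧
        ∃ (ΩK : ℂ) (Ωp : (unrIntegers 3)ˣ) (L : UnrSeries 3),
          ΩK ≠ 0 ∧ IsBDPLFunction ι' v κ γ Dt.f ΩK ((Ωp : unrIntegers 3) : ℂ_[3]) L := by
  intro W _ _ hj K _ _ N _ Dt v κ γ hγ hN hK hodd hHN hsplit hv3 hκ
  haveI : Fact (Nat.Prime 3) := ⟨Nat.prime_three⟩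
  -- an embedding datum inducing `v`
  obtain ⟨ι₀⟩ := PadicAlgCl.nonempty_ringEquiv_complex 3
  obtain ⟨ι', -, hι'⟩ := Summit.BirchSwinnertonDyer.Rank1Residual.X11b.exists_datum_forall_mem_iff 3 ι₀ hK hv3
  -- the auxiliary anticyclotomic character `λ` of Hsieh's theorem (class field theory, a tree theorem)
  obtain ⟨lam, rlam, hunit, hinfl, hAQ, hunrl, havl, hfacl⟩ :=
    Summit.BirchSwinnertonDyer.Rank1Residual.X11b.lambdaSupplyAt (p := 3) (by norm_num) ι' K κ hK hκ
  -- Hsieh 2014 Thm A at any level: the witness in `𝒪_{ℂ₃}⟦T⟧`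
  obtain ⟨A, ΩK, C, Ωp, Q, hA, hΩK, hC, hQ⟩ :=
    hT1 ι' K v κ γ Dt.f lam rlam (by norm_num) Dt.isNewformOf.1 hK hsplit hv3 hι' hHN hunit hinfl hAQ
      hunrl havl hfacl hκ hγ.out
  -- value reciprocity at the datum from BDP13, then the pointwise descent engine
  have hVR := valueReciprocityAt_of_bdp2013 hBDP W ι' K v κ Dt.f Dt.isNewformOf hN hK hodd hHN hsplit
  obtain ⟨ΩK', Ωp', L, hΩK', hL⟩ :=
    threeAdicHsiehDescentAt_of_tateSenCharacter_of_valueReciprocityAt hTS W hj K N Dt v κ γ hN hK hsplit hv3 hκ ι'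
      hVR A ΩK C Ωp Q hA hΩK hC hQ
  exact ⟨ι', hι', ΩK', Ωp', L, hΩK', hL⟩

/-! ## §3 The rank-currency plumbing at ODD `d_K` (p478070's, one `obtain` split in two) -/

/-- **Rank-currency plumbing at odd `d_K`**: Kato (`hKato`), Link A (`hA`), (LB-exist) at odd `d_K` (`hE`, the shape of §2's
conclusion), the ∀-frame value formula (LB-bdp) (`hV`) and (LB-wan) (`hWan`) force every Heegner point of level `N` to be
non-torsion at a rank-one `Ш[3^∞]`-finite `j = 0` datum over a Heegner field of ODD discriminant. Proof = p478070's
`heegnerNonTorsion_of_linkA_of_bdpExistsValue` verbatim, the EV∃ `obtain` replaced by `hE` at `(Dt, v, κ, γ)` + `hV` at the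
reading `(H, w₀, ι, τP)`. CONDITIONAL; credits nothing. [cite: CastellaGrossiLeeSkinner2022, §5.2 (proof of Thm. 5.2.1)]
[cite: Castella2018, proof of Thm. 2.3 with Thm. 3.4 (shape)] [cite: SilvermanAEC2009, IV.6.4 and VII.2.2] -/
theorem heegnerNonTorsionOddDisc_of_linkA_of_existsOddDisc_of_value_of_wan
    (hKato : ∀ (W : WeierstrassCurve ℚ) [W.IsElliptic] (p : ℕ) [Fact p.Prime],
      kato_finite_of_L_one_ne_zero W p)
    (hA : ThreeAdicControlOfRankOne)
    (hE : ∀ (W : WeierstrassCurve ℚ) [W.IsElliptic] [W.IsGloballyMinimal], W.j = 0 →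
      ∀ (K : Type) [Field K] [NumberField K] (N : ℕ) [NeZero N]
        (Dt : ModularParametrizationData W N)
        (v : HeightOneSpectrum (𝓞 K)) (κ : ZpExtension K 3) (γ : absoluteGaloisGroup K)
        [Fact (κ.IsTopGenerator γ)],
      W.conductorNorm ℤ = N → IsImaginaryQuadratic K → Odd (NumberField.discr K) →
      SatisfiesHeegnerHypothesis N K → ((Ideal.span {(3 : ℤ)}).primesOver (𝓞 K)).ncard = 2 →
      ((3 : ℕ) : 𝓞 K) ∈ v.asIdeal → κ.IsAnticyclotomic →
      ∃ ι' : PadicAlgCl 3 ≃+* ℂ,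
        (∀ (w : InfinitePlace K) (k : 𝓞 K), k ∈ v.asIdeal ↔ ‖ι'.symm (w.embedding (k : K))‖ < 1) ∧
        ∃ (ΩK : ℂ) (Ωp : (unrIntegers 3)ˣ) (L : UnrSeries 3),
          ΩK ≠ 0 ∧ IsBDPLFunction ι' v κ γ Dt.f ΩK ((Ωp : unrIntegers 3) : ℂ_[3]) L)
    (hV : ThreeAdicBDPValueAtOne) (hWan : ThreeAdicWanDivisibility) :
    ∀ (W : WeierstrassCurve ℚ) [W.IsElliptic] [W.IsGloballyMinimal], W.j = 0 →
      ∀ (K : Type) [Field K] [NumberField K] (N : ℕ) [NeZero N], W.conductorNorm ℤ = N →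
        IsImaginaryQuadratic K → Odd (NumberField.discr K) →
          SatisfiesHeegnerHypothesis N K → SatisfiesHeegnerHypothesis 3 K →
          (W.quadraticTwist (NumberField.discr K : ℚ)).entireLFunction 1 ≠ 0 →
            W.mordellWeilRank = 1 → Finite (AddCommGroup.primaryComponent W.sha 3) →
              ∀ (P : (W.baseChange K).toAffine.Point), IsHeegnerPoint N W K P →
                ¬ IsOfFinAddOrder P := by
  intro W _ _ hj K _ _ N _ hN hK hodd hHN hH3 hL hrank hsha P hP
  haveI : Fact (Nat.Prime 3) := ⟨Nat.prime_three⟩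
  -- (0) `3 = v v̄` splits in `K`
  have hsplit : ((Ideal.span {(3 : ℤ)}).primesOver (𝓞 K)).ncard = 2 := by
    simpa using hH3 3 Nat.prime_three (dvd_refl 3)
  -- (1) the rank-one data over `K` (Kato on the twist)
  obtain ⟨hrk, -, hshaK⟩ :=
    AcPConverseLinks.rank_corank_sha_baseChange_of_twist_L_one_ne_zero hKato W 3 hK hL hrank hsha
  -- (2) the anticyclotomic datum `(κ, γ)`, THE embedding at a degree-one `𝔭 ∋ 3`, `v`, `v̄`
  obtain ⟨κ, γ, 𝔭, hκ, hγ, h𝔭, he, hf⟩ :=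
    Summit.BirchSwinnertonDyer.Rank1Residual.X11b.exists_anticyclotomic_generator_degreeOnePrime
      3 K hK hH3
  haveI : Fact (κ.IsTopGenerator γ) := ⟨hγ⟩
  set ι : K →+* ℚ_[3] := Summit.BirchSwinnertonDyer.Rank1Residual.X11b.embAt K 3 𝔭 h𝔭 he hf
    with hιdef
  set v := Summit.BirchSwinnertonDyer.Rank1Residual.X11b.inducedPlace ι with hvdef
  have hv : ∀ x : 𝓞 K, x ∈ v.asIdeal ↔ ‖ι (x : K)‖ < 1 :=
    Summit.BirchSwinnertonDyer.Rank1Residual.X11b.mem_inducedPlace_iff ι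
  have hv3 : ((3 : ℕ) : 𝓞 K) ∈ v.asIdeal :=
    Summit.BirchSwinnertonDyer.Rank1Residual.X11b.natCast_mem_inducedPlace ι
  obtain ⟨vbar, hvbar, hne⟩ :=
    Summit.BirchSwinnertonDyer.Rank1Residual.X11b.exists_other_prime hH3 v hv3
  -- (3) Link A at this datum: a generator `F` of `char_Λ 𝔛` with `F(0) ≠ 0`
  obtain ⟨m, -, F, hF, hF0, -⟩ := hA W hj K N hN hK hHN hH3 ι v vbar hv hvbar hne κ hκ γ hrk hshaK
  -- (4) the Heegner datum of `P`; the Galois conjugate `P'` read through THE infinite place `w₀`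
  obtain ⟨Dt, H, ιK, hPι⟩ := hP
  obtain ⟨w₀⟩ := (inferInstance : Nonempty (InfinitePlace K))
  haveI : IsGalois ℚ K := by
    haveI : Algebra.IsQuadraticExtension ℚ K := ⟨hK.1⟩
    infer_instance
  obtain ⟨σ, hσ⟩ := ComplexEmbedding.exists_comp_symm_eq_of_comp_eq (k := ℚ) w₀.embedding ιK
    (by ext x; simp)
  set τ : K →+* K := ((σ.symm : K ≃ₐ[ℚ] K) : K →+* K) with hτdef
  set P' := WeierstrassCurve.Affine.Point.map τ.toRatAlgHom P with hP'def
  have hP' : WeierstrassCurve.Affine.Point.map w₀.embedding.toRatAlgHom P' =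
      heegnerPointComplex Dt H := by
    rw [hP'def, WeierstrassCurve.Affine.Point.map_map]
    have hcomp : w₀.embedding.toRatAlgHom.comp τ.toRatAlgHom = ιK.toRatAlgHom := by
      apply AlgHom.ext
      intro x
      have := RingHom.congr_fun hσ x
      simpa [hτdef] using this
    rw [hcomp]
    exact hPι
  -- (5) existence at the ODD-discriminant datum `(Dt, v, κ, γ)` + the ∀-frame value formula at `(H, w₀, ι, P')`
  obtain ⟨ι', hι', ΩK, Ωp, L, hΩK, hBDP⟩ := hE W hj K N Dt v κ γ hN hK hodd hHN hsplit hv3 hκ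
  obtain ⟨u, hu⟩ := hV W hj ι' K N Dt H w₀ ι v κ γ P' hN hK hHN hsplit hv3 hι' hκ hP' hv ΩK Ωp L hΩK hBDP
  -- (6) (LB-wan) along the structure map `toUnr : ℤ₃ → R₀` forces `𝓛(0) ≠ 0`
  obtain ⟨k, hk⟩ := hWan W hj ι' K N Dt v vbar κ γ hN hK hHN hsplit hι' hvbar hne hκ ΩK Ωp L hΩK
    hBDP (Summit.BirchSwinnertonDyer.Rank1Residual.X11b.Halves.toUnr 3)
    (Summit.BirchSwinnertonDyer.Rank1Residual.X11b.Halves.coe_toUnr 3)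
  have hFmem : F ∈ AcSelmer.XAc.charIdeal (W.baseChange K) 3 κ vbar ∅ γ := by
    rw [hF]; exact Ideal.mem_span_singleton_self F
  obtain ⟨G, hG⟩ := Ideal.mem_span_singleton'.mp (hk F hFmem)
  have hL0 : PowerSeries.constantCoeff L ≠ 0 := by
    intro h0
    have h1 := congrArg (fun S : UnrSeries 3 ↦ ((PowerSeries.constantCoeff S : unrIntegers 3) : ℂ_[3])) hG
    simp only [map_mul, h0, mul_zero, PowerSeries.constantCoeff_C,
      Summit.BirchSwinnertonDyer.Rank1Residual.X11b.CongruenceLimit.constantCoeff_map_apply, Subring.coe_mul,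
      Subring.coe_pow, Subring.coe_zero,
      Summit.BirchSwinnertonDyer.Rank1Residual.X11b.Halves.coe_toUnr] at h1
    have h3' : ((3 : unrIntegers 3) : ℂ_[3]) = (3 : ℂ_[3]) := by norm_cast
    rw [h3'] at h1
    have h3 : algebraMap ℚ_[3] ℂ_[3] ((PowerSeries.constantCoeff F : ℤ_[3]) : ℚ_[3]) = 0 := by
      rcases mul_eq_zero.mp h1.symm with h | h
      · exact absurd (pow_eq_zero_iff'.mp h).1 three_ne_zero
      · exact h
    rw [map_eq_zero_iff _ (algebraMap ℚ_[3] ℂ_[3]).injective] at h3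
    exact hF0 (PadicInt.coe_eq_zero.mp h3)
  -- (7) the value at `𝟙` is `u · c⁻² · (…)² · (log_ω P')²`
  have hval := UnrSeries.eq_constantCoeff_of_hasValueAt_zero hu
  -- (8) a torsion `P` makes `P'` torsion and `log_ω P' = 0`, contradicting `𝓛(0) ≠ 0`
  intro hPtor
  have hP'tor : IsOfFinAddOrder P' := by
    rw [hP'def]
    exact AddMonoidHom.isOfFinAddOrder _ hPtor
  have hlog : padicLogOmega W 3 ι P' = 0 := by
    unfold padicLogOmega
    rw [AcPConverseLinks.padicLogPoint_formalIndex_smul_eq_zero_of_isOfFinAddOrder W 3 ι hP'tor,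
      zero_div]
  apply hL0
  rw [hlog, zero_pow two_ne_zero, mul_zero, map_zero, mul_zero] at hval
  exact_mod_cast hval.symm

/-! ## §4 The v2 composition choosing a Heegner field of ODD discriminant -/

/-- **Crux B modulo Heegner non-torsion at ODD `d_K` and six refereed facts**: the v2 composition
`MordellShaFreeCutOfHeegnerNonTorsion.analyticRankOne_of_facts_of_heegnerNonTorsion` with the Heegner field CHOSEN with
`d_K ≡ 1 (mod 8)` (`exists_heegnerField_descent_of_mordellWeilRank_eq_one_of_finite_sha`, from `3`-parity, modularity,
Hoffstein–Luo, Kato), so the non-torsion input is needed at odd `d_K` only; then `grossZagierCloser_of_facts` and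
`stub_minimalModelReduction`. [cite: HoffsteinLuo1997, Theorem (§1)] [cite: GrossZagier1986, Thm. I.6.3 with V.§2]
[cite: Kato2004Asterisque, Cor. 14.3] -/
theorem analyticRankOne_of_facts_of_heegnerNonTorsionOddDisc
    (hpar : ∀ (W : WeierstrassCurve ℚ) [W.IsElliptic] (p : ℕ) [Fact p.Prime], p_parity W p)
    (hmod : ModularForms.exists_isNewformOf) (hHL : HoffsteinLuo1997_exists_twist_L_one_ne_zero)
    (hKato : ∀ (W : WeierstrassCurve ℚ) [W.IsElliptic] (p : ℕ) [Fact p.Prime],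
      kato_finite_of_L_one_ne_zero W p)
    (hHP : ∀ (W : WeierstrassCurve ℚ) (K : Type) [Field K] [NumberField K],
      exists_isHeegnerPoint W K)
    (hGZ : ∀ (W : WeierstrassCurve ℚ) (N : ℕ) [NeZero N] (K : Type) [Field K] [NumberField K],
      analyticRankEK_eq_one_iff_heegner_nonTorsion W N K)
    (hNT : ∀ (W : WeierstrassCurve ℚ) [W.IsElliptic] [W.IsGloballyMinimal], W.j = 0 →
      ∀ (K : Type) [Field K] [NumberField K] (N : ℕ) [NeZero N], W.conductorNorm ℤ = N →
        IsImaginaryQuadratic K → Odd (NumberField.discr K) →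
          SatisfiesHeegnerHypothesis N K → SatisfiesHeegnerHypothesis 3 K →
          (W.quadraticTwist (NumberField.discr K : ℚ)).entireLFunction 1 ≠ 0 →
            W.mordellWeilRank = 1 → Finite (AddCommGroup.primaryComponent W.sha 3) →
              ∀ (P : (W.baseChange K).toAffine.Point), IsHeegnerPoint N W K P →
                ¬ IsOfFinAddOrder P) :
    AnalyticRankOneOfRankOneFiniteShaThree := by
  intro D hD hr hfin
  refine MordellShaFreeCutOfHeegnerNonTorsion.stub_minimalModelReduction ?_ hD hr hfin
  intro W _ _ hj hrW hfinW
  haveI : Fact (Nat.Prime 3) := ⟨Nat.prime_three⟩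
  obtain ⟨K, _, _, hK, -, hHN, hH3, h8, hL, -, -, hfac⟩ :=
    exists_heegnerField_descent_of_mordellWeilRank_eq_one_of_finite_sha hpar hmod hHL hKato W 3 hrW hfinW 0
  have hodd : Odd (NumberField.discr K) := Int.odd_iff.mpr (by omega)
  haveI : NeZero (W.conductorNorm ℤ) := ⟨(W.conductorNorm_pos_holds).ne'⟩
  have hNT' := hNT W hj K (W.conductorNorm ℤ) rfl hK hodd hHN hH3 hL hrW hfinW
  have h1 := MordellShaFreeCutOfHeegnerNonTorsion.grossZagierCloser_of_facts hHP hGZ W K (W.conductorNorm ℤ) rfl hK hHN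
    hNT'
  rwa [hfac] at h1

/-! ## §5 The census: crux B with the EXISTENCE HALF taken from print -/

/-- **KERNEL CENSUS OF CRUX B with (LB-exist) FROM PRINT: `AnalyticRankOneOfRankOneFiniteShaThree` ⟸ six refereed facts
(`3`-parity, modularity, Hoffstein–Luo, Kato, Heegner points, Gross–Zagier + Kolyvagin) + THREE PRINTED NAMED FACTS — (T1)
`Hsieh2014.thmA_exists_isHsiehLFunction_unrPeriod_anyLevel`, Tate–Sen `TateSenCharacterVanishing 3`, BDP13
`bertoliniDarmonPrasanna2013_centralValue_reciprocity` — + the ∀-frame value formula (LB-bdp) `ThreeAdicBDPValueAtOne`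
[WRITTEN] + (LB-wan) `ThreeAdicWanDivisibility` [OPEN].** Link A is the tree theorem `threeAdicControlOfRankOne_holds`. On
this census the EXISTENCE half of the BDP road is citation-borne; the research content of crux B on the BDP road is the VALUE
formula at 𝟙 and the Wan divisibility. CONDITIONAL; credits nothing; BSD and Sylvester's conjecture untouched.
[cite: CastellaGrossiLeeSkinner2022, §5.2 (proof of Thm. 5.2.1)] [cite: Hsieh2014, Thm. A p. 712]
[cite: BertoliniDarmonPrasanna2013, Thm. 5.5 and (5.1.16) (p. 60)] [cite: BrinonConrad2009, Thm. 2.2.7] -/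
theorem cruxB_of_anyLevel_of_tateSen_of_bdp2013_of_value_of_wan
    (hpar : ∀ (W : WeierstrassCurve ℚ) [W.IsElliptic] (p : ℕ) [Fact p.Prime], p_parity W p)
    (hmod : ModularForms.exists_isNewformOf) (hHL : HoffsteinLuo1997_exists_twist_L_one_ne_zero)
    (hKato : ∀ (W : WeierstrassCurve ℚ) [W.IsElliptic] (p : ℕ) [Fact p.Prime],
      kato_finite_of_L_one_ne_zero W p)
    (hHP : ∀ (W : WeierstrassCurve ℚ) (K : Type) [Field K] [NumberField K],
      exists_isHeegnerPoint W K)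
    (hGZ : ∀ (W : WeierstrassCurve ℚ) (N : ℕ) [NeZero N] (K : Type) [Field K] [NumberField K],
      analyticRankEK_eq_one_iff_heegner_nonTorsion W N K)
    (hT1 : Hsieh2014.thmA_exists_isHsiehLFunction_unrPeriod_anyLevel) (hTS : TateSenCharacterVanishing 3)
    (hBDP : bertoliniDarmonPrasanna2013_centralValue_reciprocity)
    (hV : ThreeAdicBDPValueAtOne) (hWan : ThreeAdicWanDivisibility) :
    AnalyticRankOneOfRankOneFiniteShaThree :=
  analyticRankOne_of_facts_of_heegnerNonTorsionOddDisc hpar hmod hHL hKato hHP hGZ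
    (heegnerNonTorsionOddDisc_of_linkA_of_existsOddDisc_of_value_of_wan hKato threeAdicControlOfRankOne_holds
      (threeAdicBDPElementExistsOddDisc_of_anyLevel_of_tateSen_of_bdp2013 hT1 hTS hBDP) hV hWan)

end Summit.BirchSwinnertonDyer.BirchSwinnertonDyer.Theorems.MordellShaFreeCutThreeAdicExistenceFromPrint

end
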